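/- Copyright: the b2b-balaban cell (near-miss cell 7), T⁴-continuum fan-out, NE7b ROUND-2 swarm `t4-ne7b-formalise-*`
(seat leaf-03, answering the row owner's INTERFACE REQUEST NE7b IR-41-6 addressed to leaf-07, first refusal honoured on
the journal), row S6 pt 3b∕3c «zones of realised histories» — THE MEMORY-AGNOSTIC BRIDGE (repair route R-41-a of
R-OWNER-41-1) over leaf-07's zone skeleton `RealisesZ`.  Released under the licence of the surrounding project. -/
import Summits.QuantumFields.BalabanUV.T4Continuum.Support.HistoryZonesOrbitRealiseP
import Summits.QuantumFields.BalabanUV.T4Continuum.Support.HistoryRealiseWeak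

/-!
# History zones from orbits, VII: the memory-agnostic bridge `realisesZ_of_realisesW` and the seven W-instantiated
suppliers (INTERFACE REQUEST NE7b IR-41-6, file 3 of 3)

Summits-side support leaf of the T⁴-continuum cell (rung (B)+1 on a FINITE torus only; NOT infinite volume, NOT the
mass gap, NOT the Clay statement; NOT a proof of the spine estimate NE7b, which is the cell's OWN estimate, NOT PRINTED
and NOT PROVED).  [folklore] bookkeeping on the cell's OWN index model; nothing is quoted from print, nothing printed
is asserted, no `[cite:]` tag, no `Prop` fact minted, no definition.

WHY.  The row owner's INTERFACE REQUEST NE7b IR-41-6 (`HOME/INBOX.md` block «from b2b-balaban-t4-ne7b-p1 gen 41»,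
`CLAIMS.log` l.27257): «file the staged `HistoryZonesOrbitRealiseZ` (socket `RealisesZ`, clock-free) +
`HistoryZonesOrbitRealiseP` AS STAGED, and add the W bridge `realisesZ_of_realisesW : RealisesW L s R P Z → RealisesZ …
P Z` with the seven supplier theorems instantiated for W».  Files 1–2 are leaf-07-g17's parts V–VI; THIS FILE is the
bridge.  The owner's memory-agnostic realisation `HistoryRealiseWeak.RealisesW` (p248661; repair route R-41-a of the
located MODEL finding #3, R-OWNER-41-1: row S1b's readiness predicate reads condition (ii)'s memory FROZEN at the line's
last event, print reads the CURRENT level's `R_j` — B16 = [Balaban1989LargeFieldII] p. 384, B15 =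
[Balaban1989LargeFieldI] pp. 177, 198, manuscripts UNDER AUDIT, locators only) keeps at a renewal exactly `lastStep < h`,
condition (i), frozen pendency before `h` and `Z = orbit …`; the zone side reads of these only `lastStep < h` and
`Z = orbit …` (leaf-07-g17's site census: pendency and first readiness are IDLE at all nine destructuring sites), i.e.
exactly leaf-07's clock-free skeleton `RealisesZ`.  Hence the bridge is one structural recursion and every zone-side
supplier holds for W-realised histories with the SAME conclusion — the names row S12-W's END∕headline twins (IR-41-5),
the J∕D-layer twins and the zone-mass road call in place of parts II–IV's.

WHAT.  §1 **`realisesZ_of_realisesW`**.  §2 the seven suppliers instantiated for W, one-line wrappers over parts V–VI,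
conclusions VERBATIM the landed `Realises` ones: **`birthRegionsD_of_corrW`**, **`contact_of_corrW`**,
**`admZ_of_corr_realisesW`**, **`card_admZSet_le_of_corr_realisesW`**, **`birthRegionsD_genTW`**,
**`admZ_genT_of_realisesW`**, **`card_admZSet_genT_le_of_realisesW`**; plus `lastStep_realisesW_le` (root step ≤ last
step, the form `HistoryJoinsPlacedMult` consumes).  §3 sanity: the print-exact and the landed laws recovered through
`realisesW_of_realisesP` ∕ `realisesW_of_realises` (the three sides of the twin chain share one proof).

BY-NAME EFFECT ON THE WALL: NONE (every `WALL-NE7b-P1.md` §2 binder keeps its class; the headline of record p224237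
stands BY NAME); pre-positioning for row S12-W.  HONEST DEPENDENCY (cell): continuum YM on T⁴ ⇐ BetaPertH ∧ nine spine
estimates (0/9 proved); BetaPertH ⇐ (D1) ∧ (D4) ∧ CAP+tail; G-an2-4 gates asym, D1 and NE2/3/4.  This file changes
none of it.  NE7b NOT proved. -/

open Finset
open Literature.MathematicalPhysics.QuantumFieldTheory.Balaban1983to89
open Literature.MathematicalPhysics.QuantumFieldTheory.Balaban1983to89.B13ScaleTransfer
open Literature.MathematicalPhysics.QuantumFieldTheory.Balaban1983to89.TreeLength
open Literature.MathematicalPhysics.QuantumFieldTheory.Balaban1983to89.B16SProfile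
open Literature.MathematicalPhysics.QuantumFieldTheory.Balaban1983to89.B16MergeGeometry
open T4PersistenceDictionary T4PartnerMultiplicity
open Summit.QuantumFields.BalabanUV.T4Continuum.PlacementSkeleton
open Summit.QuantumFields.BalabanUV.T4Continuum.Crowding
open Summit.QuantumFields.BalabanUV.T4Continuum.ZoneSkeleton
open Summit.QuantumFields.BalabanUV.T4Continuum.ZoneCrowd
open Summit.QuantumFields.BalabanUV.T4Continuum.ZoneTorus
open Summit.QuantumFields.BalabanUV.T4Continuum.HistoryAdmissible
open Summit.QuantumFields.BalabanUV.T4Continuum.HistoryRealise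
open Summit.QuantumFields.BalabanUV.T4Continuum.HistoryRealisePrint
open Summit.QuantumFields.BalabanUV.T4Continuum.HistoryRealiseWeak
open Summit.QuantumFields.BalabanUV.T4Continuum.HistoryRealiseCells
open Summit.QuantumFields.BalabanUV.T4Continuum.HistoryGen

namespace Summit.QuantumFields.BalabanUV.T4Continuum.HistoryZones

noncomputable section

variable {d : ℕ}

/-! ## §1 The bridge: the memory-agnostic realisation has the zone skeleton -/

/-- **BRIDGE 3: the owner's MEMORY-AGNOSTIC realisation `RealisesW` has the zone skeleton** (structural recursion; at
a renewal the clause's `G.lastStep < h` and `Z = orbit …` are kept, condition (i) and the frozen first-readiness are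
dropped; at a join the two `PendingBefore` clauses are dropped). [folklore] -/
theorem realisesZ_of_realisesW {L : ℕ} {s R : ℕ → ℕ} :
    ∀ (P : PGen (Pt d × Finset (Pt d))) (Z : Finset (Pt d)), RealisesW L s R P Z → RealisesZ L s P Z
  | .birth _ _ _, _, h => h
  | .renew G h, Z, hP => by
      obtain ⟨ZG, hG, ht, -, -, hZ⟩ := hP
      exact ⟨ZG, realisesZ_of_realisesW G ZG hG, ht, hZ⟩
  | .join X Y sj, Z, hP => by
      obtain ⟨ZX, ZY, hX, hY, htX, htY, -, -, hac, hZ⟩ := hP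
      exact ⟨ZX, ZY, realisesZ_of_realisesW X ZX hX, realisesZ_of_realisesW Y ZY hY, htX, htY, hac, hZ⟩

/-- a weakly realised history has `rootStep ≤ lastStep` (the zone skeleton's `lastStep_realisesZ_le` through the
bridge; the form the placed-joins layer consumes) [folklore] -/
theorem lastStep_realisesW_le {L : ℕ} {s R : ℕ → ℕ} (P : PGen (Pt d × Finset (Pt d))) (Z : Finset (Pt d))
    (hR : RealisesW L s R P Z) : P.rootStep ≤ P.lastStep :=
  lastStep_realisesZ_le P Z (realisesZ_of_realisesW P Z hR)

variable {ε : Type*} [DecidableEq ε] {sh : ε → PEv} {pay : ε → Pt d × Finset (Pt d)}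

section Walk

variable {L : ℕ} (hL : 3 ≤ L) {n : ℕ} (hn : 0 < n) {s : ℕ → ℕ} (hs : ∀ t, s (t + 1) ≤ s t)
  (hdrop : ∀ m, DropCtl s m) {R : ℕ → ℕ} {K : ℕ}
include hL hn hs hdrop

/-! ## §2 The seven suppliers instantiated for W -/

/-- **W-TWIN of `birthRegionsD_of_corr`** (the owner's typed target: `Corr sh pay G P → RealisesW L s R P Z →
P.lastStep ≤ K → BirthRegionsD sh n L K (levelOf s K) (4 * 2 ^ d) 32 G (regR sh pay n L K (levelOf s K))`).
[folklore] -/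
theorem birthRegionsD_of_corrW {P : PGen (Pt d × Finset (Pt d))} {G : Gen ε} {Z : Finset (Pt d)}
    (hc : Corr sh pay G P) (hR : RealisesW L s R P Z) (hK : P.lastStep ≤ K) :
    BirthRegionsD sh n L K (levelOf s K) (4 * 2 ^ d) 32 G (regR sh pay n L K (levelOf s K)) :=
  birthRegionsD_of_corrZ hL hn hs hdrop hc (realisesZ_of_realisesW P Z hR) hK

/-- **W-TWIN of `contact_of_corr`.** [folklore] -/
theorem contact_of_corrW {P : PGen (Pt d × Finset (Pt d))} {G : Gen ε} {Z : Finset (Pt d)}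
    (hc : Corr sh pay G P) (hR : RealisesW L s R P Z) (hK : P.lastStep ≤ K) {X Y : Gen ε} {e : ε}
    (hsub : Sub (Gen.merge X Y e) G) :
    ∃ z, z ∈ regZoneD sh n L K (levelOf s K) 32 (regR sh pay n L K (levelOf s K)) (sh e).step X ∧
      z ∈ regZoneD sh n L K (levelOf s K) 32 (regR sh pay n L K (levelOf s K)) (sh e).step Y :=
  contact_of_corrZ hL hn hs hdrop P G Z hc (realisesZ_of_realisesW P Z hR) hK X Y e hsub

open scoped Classical in
/-- **W-TWIN of `admZ_of_corr_realises`.** [folklore] -/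
theorem admZ_of_corr_realisesW {P : PGen (Pt d × Finset (Pt d))} {G : Gen ε} {Z : Finset (Pt d)}
    (hc : Corr sh pay G P) (hR : RealisesW L s R P Z) (hK : P.lastStep ≤ K) {ϑ : ℝ} (hϑ : 0 < ϑ) (hϑ1 : ϑ ≤ 1)
    (hchr : Chrono (PEv.step ∘ sh) G) {E : Finset ε} {G' : Gen ↥E} (hGG : gmap Subtype.val G' = G)
    (hN : 0 < n * L ^ K) :
    AdmZ (nearD n L K (levelOf s K) (theta (levelOf s K) ϑ))
      (fun t W => extD sh n L K (levelOf s K) ϑ G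
        (regZoneD sh n L K (levelOf s K) 32 (regR sh pay n L K (levelOf s K))) t (gmap Subtype.val W))
      ((PEv.step ∘ sh) ∘ Subtype.val) G' (fun b => placeD sh pay n L K hN (levelOf s K) b.1) :=
  admZ_of_corr_realisesZ hL hn hs hdrop hc (realisesZ_of_realisesW P Z hR) hK hϑ hϑ1 hchr hGG hN

open scoped Classical in
/-- **W-TWIN of `card_admZSet_le_of_corr_realises`.** [folklore] -/
theorem card_admZSet_le_of_corr_realisesW (W : ε → ℕ) {P : PGen (Pt d × Finset (Pt d))} {G : Gen ε}
    {Z : Finset (Pt d)} (hc : Corr sh pay G P) (hR : RealisesW L s R P Z) (hK : P.lastStep ≤ K) {σ : ℝ}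
    (h0 : 0 < σ) (h1 : σ < 1) (hσL : 1 ≤ (L : ℝ) * σ ^ 4) (hW : G.WF W) (hchr : Chrono (PEv.step ∘ sh) G)
    (hk2 : ∀ m ∈ merges G, (sh m).kind ≠ 0) (E : Finset ε) (hE : G.events ⊆ E) (z c₀' : TCell d (n * L ^ K)) :
    ((admZSet (nearD n L K (levelOf s K) (theta (levelOf s K) (σ ^ 2)))
        (fun t W => extD sh n L K (levelOf s K) (σ ^ 2) G
          (regZoneD sh n L K (levelOf s K) 32 (regR sh pay n L K (levelOf s K))) t (gmap Subtype.val W))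
        ((PEv.step ∘ sh) ∘ Subtype.val) (grestrict E G hE) (grestrict E G hE).root z c₀').card : ℝ) ≤
      ((2 : ℝ) ^ d * (σ ^ 2)⁻¹ ^ d *
          (max ((4 : ℝ) * 2 ^ d + 2 * (32 : ℕ)) ((2 * (32 : ℕ) + 1) / (1 - σ ^ 2) + 1) +
            2 * ((2 * (32 : ℕ) + 1) / (1 - σ ^ 2)) + 1) ^ d) ^ (merges G).card *
        (∏ e ∈ merges G, Q (wcntS sh G) σ (sh e).step ^ (d : ℝ)) *
          ((L : ℝ) ^ d) ^ partnerAges (PEv.step ∘ sh) G :=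
  card_admZSet_le_of_corr_realisesZ hL hn hs hdrop W hc (realisesZ_of_realisesW P Z hR) hK h0 h1 hσL hW hchr hk2 E
    hE z c₀'

end Walk

section Component

variable {α π : Type*} (cellP : π → Pt d × Finset (Pt d)) [DecidableEq α] [DecidableEq π]
variable {L : ℕ} (hL : 3 ≤ L) {n : ℕ} (hn : 0 < n) {s : ℕ → ℕ} (hs : ∀ t, s (t + 1) ≤ s t)
  (hdrop : ∀ m, DropCtl s m) {R : ℕ → ℕ} {K : ℕ}
include hL hn hs hdrop

/-- **W-TWIN of `birthRegionsD_genT`.** [folklore] -/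
theorem birthRegionsD_genTW (P : Pedigree α π) (hS : ∀ c c', Part.old c' true ∈ P.parts c → P.step c' + 1 = P.step c)
    (c : α) {Z : Finset (Pt d)} (hR : RealisesW L s R (P.toPGen cellP c) Z) (hK : (P.toPGen cellP c).lastStep ≤ K) :
    BirthRegionsD Prod.fst n L K (levelOf s K) (4 * 2 ^ d) 32 (P.genT c)
      (regR Prod.fst (payOfTag cellP) n L K (levelOf s K)) :=
  birthRegionsD_genTZ cellP hL hn hs hdrop P hS c (realisesZ_of_realisesW _ Z hR) hK

open scoped Classical in
/-- **W-TWIN of `admZ_genT_of_realises`.** [folklore] -/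
theorem admZ_genT_of_realisesW (P : Pedigree α π)
    (hS : ∀ c c', Part.old c' true ∈ P.parts c → P.step c' + 1 = P.step c) (c : α) {Z : Finset (Pt d)}
    (hR : RealisesW L s R (P.toPGen cellP c) Z) (hK : (P.toPGen cellP c).lastStep ≤ K) {ϑ : ℝ} (hϑ : 0 < ϑ)
    (hϑ1 : ϑ ≤ 1) (hchr : Chrono (PEv.step ∘ Prod.fst) (P.genT c)) {E : Finset (Lab α π)} {G' : Gen ↥E}
    (hGG : gmap Subtype.val G' = P.genT c) (hN : 0 < n * L ^ K) :
    AdmZ (nearD n L K (levelOf s K) (theta (levelOf s K) ϑ))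
      (fun t W => extD Prod.fst n L K (levelOf s K) ϑ (P.genT c)
        (regZoneD Prod.fst n L K (levelOf s K) 32 (regR Prod.fst (payOfTag cellP) n L K (levelOf s K))) t
        (gmap Subtype.val W))
      ((PEv.step ∘ Prod.fst) ∘ Subtype.val) G'
      (fun b => placeD Prod.fst (payOfTag cellP) n L K hN (levelOf s K) b.1) :=
  admZ_genT_of_realisesZ cellP hL hn hs hdrop P hS c (realisesZ_of_realisesW _ Z hR) hK hϑ hϑ1 hchr hGG hN

open scoped Classical in
/-- **W-TWIN of `card_admZSet_genT_le_of_realises`.** [folklore] -/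
theorem card_admZSet_genT_le_of_realisesW (W : Lab α π → ℕ) (P : Pedigree α π)
    (hS : ∀ c c', Part.old c' true ∈ P.parts c → P.step c' + 1 = P.step c) (c : α) {Z : Finset (Pt d)}
    (hR : RealisesW L s R (P.toPGen cellP c) Z) (hK : (P.toPGen cellP c).lastStep ≤ K) {σ : ℝ} (h0 : 0 < σ)
    (h1 : σ < 1) (hσL : 1 ≤ (L : ℝ) * σ ^ 4) (hW : (P.genT c).WF W) (hchr : Chrono (PEv.step ∘ Prod.fst) (P.genT c))
    (hk2 : ∀ m ∈ merges (P.genT c), (Prod.fst m : PEv).kind ≠ 0) (E : Finset (Lab α π))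
    (hE : (P.genT c).events ⊆ E) (z c₀' : TCell d (n * L ^ K)) :
    ((admZSet (nearD n L K (levelOf s K) (theta (levelOf s K) (σ ^ 2)))
        (fun t W => extD Prod.fst n L K (levelOf s K) (σ ^ 2) (P.genT c)
          (regZoneD Prod.fst n L K (levelOf s K) 32 (regR Prod.fst (payOfTag cellP) n L K (levelOf s K))) t
          (gmap Subtype.val W))
        ((PEv.step ∘ Prod.fst) ∘ Subtype.val) (grestrict E (P.genT c) hE) (grestrict E (P.genT c) hE).root z c₀').card
        : ℝ) ≤
      ((2 : ℝ) ^ d * (σ ^ 2)⁻¹ ^ d *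
          (max ((4 : ℝ) * 2 ^ d + 2 * (32 : ℕ)) ((2 * (32 : ℕ) + 1) / (1 - σ ^ 2) + 1) +
            2 * ((2 * (32 : ℕ) + 1) / (1 - σ ^ 2)) + 1) ^ d) ^ (merges (P.genT c)).card *
        (∏ e ∈ merges (P.genT c), Q (wcntS Prod.fst (P.genT c)) σ (Prod.fst e : PEv).step ^ (d : ℝ)) *
          ((L : ℝ) ^ d) ^ partnerAges (PEv.step ∘ Prod.fst) (P.genT c) :=
  card_admZSet_genT_le_of_realisesZ cellP hL hn hs hdrop W P hS c (realisesZ_of_realisesW _ Z hR) hK h0 h1 hσL hW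
    hchr hk2 E hE z c₀'

end Component

/-! ## §3 Sanity: the three sides of the twin chain share one proof -/

namespace SanityZOR7

/-- the landed `birthRegionsD_of_corr` (hypothesis `Realises`) recovered through `realisesW_of_realises` and the W-twin
[folklore] -/
example {ε : Type*} [DecidableEq ε] {sh : ε → PEv} {pay : ε → Pt d × Finset (Pt d)} {L : ℕ} (hL : 3 ≤ L) {n : ℕ}
    (hn : 0 < n) {s : ℕ → ℕ} (hs : ∀ t, s (t + 1) ≤ s t) (hdrop : ∀ m, DropCtl s m) {R : ℕ → ℕ} {K : ℕ}
    {P : PGen (Pt d × Finset (Pt d))} {G : Gen ε} {Z : Finset (Pt d)} (hc : Corr sh pay G P)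
    (hR : Realises L s R P Z) (hK : P.lastStep ≤ K) :
    BirthRegionsD sh n L K (levelOf s K) (4 * 2 ^ d) 32 G (regR sh pay n L K (levelOf s K)) :=
  birthRegionsD_of_corrW hL hn hs hdrop hc (realisesW_of_realises P Z hR) hK

/-- the print-exact twin `birthRegionsD_of_corrP` recovered through `realisesW_of_realisesP` [folklore] -/
example {ε : Type*} [DecidableEq ε] {sh : ε → PEv} {pay : ε → Pt d × Finset (Pt d)} {L : ℕ} (hL : 3 ≤ L) {n : ℕ}
    (hn : 0 < n) {s : ℕ → ℕ} (hs : ∀ t, s (t + 1) ≤ s t) (hdrop : ∀ m, DropCtl s m) {R : ℕ → ℕ} {K : ℕ}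
    {P : PGen (Pt d × Finset (Pt d))} {G : Gen ε} {Z : Finset (Pt d)} (hc : Corr sh pay G P)
    (hR : RealisesP L s R P Z) (hK : P.lastStep ≤ K) :
    BirthRegionsD sh n L K (levelOf s K) (4 * 2 ^ d) 32 G (regR sh pay n L K (levelOf s K)) :=
  birthRegionsD_of_corrW hL hn hs hdrop hc (realisesW_of_realisesP P Z hR) hK

/-- the bridges compose: `Realises → RealisesW → RealisesZ` agrees with leaf-07's bridge 1 (proof-irrelevant) [folklore] -/
example {L : ℕ} {s R : ℕ → ℕ} (P : PGen (Pt d × Finset (Pt d))) (Z : Finset (Pt d)) (h : Realises L s R P Z) :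
    realisesZ_of_realisesW P Z (realisesW_of_realises P Z h) = realisesZ_of_realises P Z h := rfl

end SanityZOR7

end

end Summit.QuantumFields.BalabanUV.T4Continuum.HistoryZones
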